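import Summits.QuantumFields.QCD.Theorems.SpectralDefectExtinctionWegnerEstimateStubResolventLocalSpectralSum
import Summits.QuantumFields.QCD.Theorems.SpectralDefectExtinctionExtinctionBuildsQCDStubFermiProjectorScreeningMassPin
import Literature.Barriers.QuantumFields.WilsonDeterminantSign
import Literature.MathematicalPhysics.QuantumFieldTheory.QCDPhaseQuenchedPositivity
import Literature.MathematicalPhysics.QuantumFieldTheory.QCDAsymptoticScalingCouplingDivergence
import Literature.MathematicalPhysics.QuantumLattice.OverlapKernelTools

/-!
# Stub A `stub_conditionalSmallBall` of line `determinant-tilt` (crux `SpectralDefectExtinction.ExtinctionBuildsQCD`,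
# item stmt-QuantumFields-18064) — AUXILIARY LEMMAS (helper file; the registered stub is in the sibling
# `…StubConditionalSmallBall.lean`, which imports this one)

§1 (Q) a quasi-mode localises the resolvent trace: for a Hermitian `A`, a non-zero `φ` supported in `P` with
`‖Aφ‖² < τ²‖φ‖²` forces `1 ≤ (16τ/3) Σ_{p ∈ P} Im((A − 2τ·i)⁻¹)_{pp}` (Parseval + Cauchy–Schwarz +
`ResolventCell.stub_resolventLocalSpectralSum`); §2 taxi geometry on the torus (cells `x + box 4 R` have taxi radius `4R`,
taxi balls have `≤ (2r+1)⁴` sites uniformly in the torus size); §3 the eventual constants along a regularisation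
(`β_k ≤ K a_k⁻²` from asymptotic scaling, `Z_k ≥ c_Z/2` from mass scaling, CAP ⇒ `(2L_k+1)⁴(1+β_k^q) ≤ K (Z_k/a_k)^p`;
the Hölder level algebra `τ(2τ)^{−θ} ≤ (τ/w)^{1−θ}`).
References (prose): Bhatia, Matrix Analysis III (spectral theorem); Montvay–Münster §3.3.3, §5.1 (two-loop scaling).
-/

noncomputable section

namespace Summit.QuantumFields.QCD.Cruxes.ExtinctionBuildsQCD.DeterminantTilt

open scoped BigOperators Topology Classical MeasureTheory Matrix ENNReal
open Filter MeasureTheory Matrix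
open Literature.MathematicalPhysics.QuantumLattice Literature.MathematicalPhysics.QuantumFieldTheory
  Literature.Probability.LatticeModels Literature.MathematicalPhysics.AQFT
open Summit.QuantumFields.QCD.Theses.SpectralDefectExtinction

/-! ## §1 (Q) Quasi-mode ⇒ localised resolvent trace (deterministic linear algebra) -/

section QuasiMode

variable {n : Type} [Fintype n] [DecidableEq n]

/-- An isometry preserves the `ℓ²` sum (adapted from `WegnerEstimateNegative.sum_norm_sq_mulVec_of_isometry`). -/
private theorem sum_norm_sq_mulVec_of_isometry' {A : Matrix n n ℂ} (hA : Aᴴ * A = 1) (w : n → ℂ) :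
    ∑ i, ‖(A *ᵥ w) i‖ ^ 2 = ∑ i, ‖w i‖ ^ 2 := by
  have h : ∀ v : n → ℂ, (star v ⬝ᵥ v).re = ∑ i, ‖v i‖ ^ 2 := fun v => by
    rw [dotProduct, Complex.re_sum]
    refine Finset.sum_congr rfl fun i _ => ?_
    rw [Pi.star_apply, Complex.star_def, Complex.conj_mul', ← Complex.ofReal_pow, Complex.ofReal_re]
  rw [← h, ← h, star_mulVec, ← dotProduct_mulVec, mulVec_mulVec, hA, one_mulVec]

/-- **(Q) Quasi-mode ⇒ localised resolvent trace.**  For a Hermitian `A`, `τ > 0` and a non-zero `φ` supported in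
`P` with `‖Aφ‖² < τ²‖φ‖²`: `1 ≤ (16τ/3) Σ_{p ∈ P} Im((A − 2τ·i)⁻¹)_{pp}` (Parseval in the eigenbasis: the window
`|λ| < 2τ` carries `> 3/4` of `‖φ‖²`; Cauchy–Schwarz on the support; `ε/(λ²+ε²) ≥ 1/(2ε)` on the window;
`ResolventCell.stub_resolventLocalSpectralSum`). -/
theorem quasimode_resolvent_trace (A : Matrix n n ℂ) (hA : A.IsHermitian) (P : Finset n) {τ : ℝ}
    (hτ : 0 < τ) (φ : n → ℂ) (hφ0 : φ ≠ 0) (hφP : ∀ p ∉ P, φ p = 0)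
    (hφ : ∑ p, ‖(A *ᵥ φ) p‖ ^ 2 < τ ^ 2 * ∑ p, ‖φ p‖ ^ 2) :
    1 ≤ 16 * τ / 3 * ∑ p ∈ P, ((A - (((2 * τ : ℝ) : ℂ) * Complex.I) • (1 : Matrix n n ℂ))⁻¹ p p).im := by
  rw [Cruxes.WegnerEstimate.ResolventCell.stub_resolventLocalSpectralSum n A hA P (2 * τ) (by positivity)]
  set V : Matrix n n ℂ := (hA.eigenvectorUnitary : Matrix n n ℂ) with hVdef
  set lam : n → ℝ := hA.eigenvalues with hlam
  set mj : n → ℝ := fun j => ∑ p ∈ P, ‖(hA.eigenvectorBasis j) p‖ ^ 2 with hmj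
  set w : n → ℂ := star V *ᵥ φ with hw
  set N : ℝ := ∑ p, ‖φ p‖ ^ 2 with hN
  have hV1 : star V * V = 1 := Unitary.star_mul_self_of_mem (hA.eigenvectorUnitary).2
  have hV2 : V * star V = 1 := Unitary.mul_star_self_of_mem (hA.eigenvectorUnitary).2
  have hN0 : 0 < N := by
    obtain ⟨p, hp⟩ : ∃ p, φ p ≠ 0 := by by_contra h; push Not at h; exact hφ0 (funext h)
    exact lt_of_lt_of_le (by positivity : 0 < ‖φ p‖ ^ 2)
      (Finset.single_le_sum (f := fun p => ‖φ p‖ ^ 2) (fun _ _ => by positivity) (Finset.mem_univ p))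
  -- Parseval `Σ_j ‖w j‖² = N` and `‖Aφ‖² = Σ_j λ_j² ‖w j‖²`
  have hwN : ∑ j, ‖w j‖ ^ 2 = N := by
    rw [hw, sum_norm_sq_mulVec_of_isometry' (by simpa [Matrix.star_eq_conjTranspose] using hV2)]
  have hAφ : ∑ p, ‖(A *ᵥ φ) p‖ ^ 2 = ∑ j, lam j ^ 2 * ‖w j‖ ^ 2 := by
    have hspec : A = V * diagonal (RCLike.ofReal ∘ hA.eigenvalues) * star V := hA.spectral_theorem
    have h1 : A *ᵥ φ = V *ᵥ (diagonal (RCLike.ofReal ∘ hA.eigenvalues) *ᵥ w) := by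
      rw [hw, mulVec_mulVec, mulVec_mulVec, ← hspec]
    rw [h1, sum_norm_sq_mulVec_of_isometry' (by simpa [Matrix.star_eq_conjTranspose] using hV1)]
    refine Finset.sum_congr rfl fun j _ => ?_
    rw [mulVec_diagonal, norm_mul, mul_pow]
    simp [hlam]
  -- Cauchy–Schwarz on the support: `‖w j‖² ≤ m_j N`
  have hCS : ∀ j, ‖w j‖ ^ 2 ≤ mj j * N := by
    intro j
    have hwj : w j = ∑ p ∈ P, star (V p j) * φ p := by
      rw [hw, mulVec, dotProduct, ← Finset.sum_subset (Finset.subset_univ P)]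
      · exact Finset.sum_congr rfl fun p _ => by rw [star_apply]
      · exact fun p _ hp => by rw [hφP p hp, mul_zero]
    have h1 : ‖w j‖ ≤ ∑ p ∈ P, ‖V p j‖ * ‖φ p‖ :=
      hwj ▸ (norm_sum_le _ _).trans (le_of_eq (Finset.sum_congr rfl fun p _ => by rw [norm_mul, norm_star]))
    have h3 : ∑ p ∈ P, ‖φ p‖ ^ 2 ≤ N :=
      Finset.sum_le_sum_of_subset_of_nonneg (Finset.subset_univ P) fun _ _ _ => by positivity
    have h4 : ∑ p ∈ P, ‖V p j‖ ^ 2 = mj j := by simp only [hmj, hVdef, Matrix.IsHermitian.eigenvectorUnitary_apply]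
    calc ‖w j‖ ^ 2 ≤ (∑ p ∈ P, ‖V p j‖ * ‖φ p‖) ^ 2 := pow_le_pow_left₀ (norm_nonneg _) h1 2
      _ ≤ (∑ p ∈ P, ‖V p j‖ ^ 2) * ∑ p ∈ P, ‖φ p‖ ^ 2 := Finset.sum_mul_sq_le_sq_mul_sq P _ _
      _ ≤ mj j * N := h4 ▸ mul_le_mul_of_nonneg_left h3 (Finset.sum_nonneg fun _ _ => by positivity)
  -- the window `|λ_j| < 2τ` carries more than `3/4` of the mass
  set win : Finset n := Finset.univ.filter (fun j => |lam j| < 2 * τ) with hwin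
  have hoff : 4 * τ ^ 2 * ∑ j ∈ Finset.univ.filter (fun j => ¬ |lam j| < 2 * τ), ‖w j‖ ^ 2 ≤
      ∑ p, ‖(A *ᵥ φ) p‖ ^ 2 := by
    rw [Finset.sum_filter, Finset.mul_sum, hAφ]
    refine Finset.sum_le_sum fun j _ => ?_
    split_ifs with hj
    · rw [mul_zero]; positivity
    · have hj' : 2 * τ ≤ |lam j| := not_lt.1 hj
      nlinarith [sq_nonneg ‖w j‖, sq_abs (lam j), mul_le_mul hj' hj' (by positivity) (abs_nonneg _)]
  have hmwin : 3 / 4 < ∑ j ∈ win, mj j := by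
    have h0 := Finset.sum_filter_add_sum_filter_not Finset.univ (fun j => |lam j| < 2 * τ) (fun j => ‖w j‖ ^ 2)
    rw [hwN] at h0
    have h1 : ∑ j ∈ win, ‖w j‖ ^ 2 ≤ (∑ j ∈ win, mj j) * N := by
      rw [Finset.sum_mul]; exact Finset.sum_le_sum fun j _ => hCS j
    refine lt_of_mul_lt_mul_right (lt_of_lt_of_le ?_ h1) hN0.le
    rw [hwin]
    nlinarith [mul_pos hN0 (pow_pos hτ 2)]
  -- the spectral sum on the window
  have hmj0 : ∀ j, 0 ≤ mj j := fun j => Finset.sum_nonneg fun _ _ => by positivity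
  have hlow : 1 / (4 * τ) * ∑ j ∈ win, mj j ≤ ∑ j, mj j * (2 * τ / (lam j ^ 2 + (2 * τ) ^ 2)) := by
    rw [Finset.mul_sum]
    refine le_trans (Finset.sum_le_sum fun j hj => ?_) (Finset.sum_le_sum_of_subset_of_nonneg
      (Finset.filter_subset _ _) fun j _ _ => mul_nonneg (hmj0 j) (by positivity))
    rw [mul_comm]
    refine mul_le_mul_of_nonneg_left ?_ (hmj0 j)
    have hj' : |lam j| < 2 * τ := (Finset.mem_filter.1 hj).2
    rw [div_le_div_iff₀ (by positivity) (by positivity)]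
    nlinarith [sq_abs (lam j), abs_nonneg (lam j)]
  calc (1 : ℝ) = 16 * τ / 3 * (1 / (4 * τ) * (3 / 4)) := by field_simp; norm_num
    _ ≤ 16 * τ / 3 * (1 / (4 * τ) * ∑ j ∈ win, mj j) := by gcongr
    _ ≤ _ := mul_le_mul_of_nonneg_left hlow (by positivity)

end QuasiMode

/-! ## §2 Taxi geometry of cells and balls on the torus -/

section Geometry

variable {L : ℕ} [NeZero L]

/-- An edge based in the cell `x + box 4 R` (taxi radius `≤ 4R`) with `|x − x₀|₁ ≤ r` is within `r + 4R` of `x₀`. -/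
theorem not_far_of_mem_cell {R r : ℕ} {x x₀ : TorusSite 4 L} (hx : torusTaxiDist x x₀ ≤ r)
    {e : TorusSite 4 L × Fin 4} (he : ∃ y ∈ box 4 R, e.1 = x + Torus.proj L y) : ¬ r + 4 * R < torusTaxiDist e.1 x₀ := by
  obtain ⟨y, hy, hye⟩ := he
  rw [mem_box] at hy
  have h1 : torusTaxiDist e.1 x ≤ 4 * R := by
    rw [hye]
    unfold torusTaxiDist
    calc ∑ i, min ((x + Torus.proj L y) i - x i).val (L - ((x + Torus.proj L y) i - x i).val) ≤ ∑ _i : Fin 4, R := by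
          refine Finset.sum_le_sum fun i _ => ?_
          have h1 : (x + Torus.proj L y) i - x i = ((y i : ℤ) : ZMod L) := by simp [Torus.proj_apply]
          rw [h1, ← ZMod.valMinAbs_natAbs_eq_min]
          have := hy i
          have := ZMod.natAbs_min_of_le_div_two L _ (y i) (by rw [ZMod.coe_valMinAbs]) (ZMod.natAbs_valMinAbs_le _)
          omega
      _ = 4 * R := by simp
  have h2 := torusTaxiDist_triangle e.1 x x₀
  omega

/-- **Taxi balls are small uniformly in the torus size**: `#{x : |x − x₀|₁ ≤ r} ≤ (2r+1)⁴`
(the ball is covered by the cube `x₀ + box 4 r` via minimal representatives). -/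
theorem card_taxiBall_le (x₀ : TorusSite 4 L) (r : ℕ) :
    (Finset.univ.filter (fun x : TorusSite 4 L => torusTaxiDist x x₀ ≤ r)).card ≤ (2 * r + 1) ^ 4 := by
  have hsub : Finset.univ.filter (fun x : TorusSite 4 L => torusTaxiDist x x₀ ≤ r) ⊆
      (box 4 r).image (fun y => x₀ + Torus.proj L y) := by
    intro x hx
    have hxr : torusTaxiDist x x₀ ≤ r := (Finset.mem_filter.1 hx).2
    refine Finset.mem_image.2 ⟨fun i => (x i - x₀ i).valMinAbs, ?_, funext fun i => by simp [ZMod.coe_valMinAbs]⟩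
    rw [mem_box]
    intro i
    have h1 : ((x i - x₀ i).valMinAbs).natAbs ≤ r := by
      rw [ZMod.valMinAbs_natAbs_eq_min]
      exact le_trans (Finset.single_le_sum (f := fun j => min (x j - x₀ j).val (L - (x j - x₀ j).val))
        (fun _ _ => Nat.zero_le _) (Finset.mem_univ i)) hxr
    omega
  exact (Finset.card_le_card hsub).trans (Finset.card_image_le.trans (card_box 4 r).le)

end Geometry

/-! ## §3 Eventual bookkeeping along the regularisation -/

section Bookkeeping

variable {Nf : ℕ}

/-- Hölder bookkeeping of the level: `τ (2τ)^{−θ} ≤ (τ/w)^{1−θ}` for `0 < τ`, `0 < w ≤ 1`, `θ ∈ [0,1]`. -/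
theorem level_rpow_le {τ w θ : ℝ} (hτ : 0 < τ) (hw0 : 0 < w) (hw1 : w ≤ 1) (hθ : 0 ≤ θ) (hθ1 : θ ≤ 1) :
    τ * (2 * τ) ^ (-θ) ≤ (τ / w) ^ (1 - θ) := by
  have h2 : (2 : ℝ) ^ (-θ) ≤ 1 := Real.rpow_le_one_of_one_le_of_nonpos (by norm_num) (by linarith)
  have hw : w ^ (1 - θ) ≤ 1 := Real.rpow_le_one hw0.le hw1 (by linarith)
  calc τ * (2 * τ) ^ (-θ) = τ * ((2 : ℝ) ^ (-θ) * τ ^ (-θ)) := by rw [Real.mul_rpow (by norm_num) hτ.le]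
    _ ≤ τ * (1 * τ ^ (-θ)) := by gcongr
    _ = τ ^ (1 - θ) := by rw [one_mul, sub_eq_add_neg, Real.rpow_add hτ, Real.rpow_one]
    _ = (τ / w) ^ (1 - θ) * w ^ (1 - θ) := by
        rw [← Real.mul_rpow (div_nonneg hτ.le hw0.le) hw0.le, div_mul_cancel₀ _ hw0.ne']
    _ ≤ (τ / w) ^ (1 - θ) * 1 := mul_le_mul_of_nonneg_left hw (Real.rpow_nonneg (div_nonneg hτ.le hw0.le) _)
    _ = (τ / w) ^ (1 - θ) := mul_one _

/-- **Asymptotic scaling bounds the inverse bare coupling by a power of the cutoff** (`N_f ≤ 16`): eventually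
`1 ≤ β_k ≤ K a_k⁻²` (`β_k = afBeta + o(1)`, `afBeta ≤ (2b₀ + 2|b₁/b₀|) X`, `X = 1/(a²Λ²) ≥ 4`, since `log X ≤ X`). -/
theorem eventually_beta_le (hNf : Nf ≤ 16) (reg : QCDRegularisation Nf) (hAS : (reg.scheme 0 0 0).HasAsymptoticScaling) :
    ∃ K : ℝ, 0 < K ∧ ∀ᶠ k in atTop, 1 ≤ reg.β k ∧ reg.β k ≤ K * (reg.a k)⁻¹ ^ 2 := by
  have hβ1 : ∀ᶠ k in atTop, 1 ≤ reg.β k :=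
    (QCDRegularisation.tendsto_beta_atTop_of_hasAsymptoticScaling hNf reg 0 0 0 hAS).eventually_ge_atTop 1
  obtain ⟨Λ, hΛ, hε⟩ := hAS
  change Tendsto (fun k => reg.β k - afBeta Nf Λ (reg.a k)) atTop (𝓝 0) at hε
  have hb₀ : 0 < betaCoeff₀ Nf := by
    have h16 : (Nf : ℝ) ≤ 16 := by exact_mod_cast hNf
    unfold betaCoeff₀; exact div_pos (by linarith) (by positivity)
  set K₁ : ℝ := 2 * betaCoeff₀ Nf + 2 * |betaCoeff₁ Nf / betaCoeff₀ Nf| with hK₁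
  refine ⟨1 + K₁ / Λ ^ 2, by positivity, ?_⟩
  filter_upwards [hβ1, (tendsto_order.1 hε).2 1 one_pos,
    reg.tendsto_a.eventually (eventually_lt_nhds (by positivity : (0:ℝ) < min 1 (1 / (2 * Λ))))] with k hk1 hk2 hk4
  refine ⟨hk1, ?_⟩
  have hapos := reg.a_pos k
  have ha1 : reg.a k < 1 := hk4.trans_le (min_le_left _ _)
  have haΛ : reg.a k * Λ < 1 / 2 := by
    have h := (lt_div_iff₀ (by positivity)).1 (hk4.trans_le (min_le_right _ _)); linarith
  set X : ℝ := 1 / (reg.a k ^ 2 * Λ ^ 2) with hXdef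
  have hX4 : 4 ≤ X := by
    have h := mul_lt_mul'' haΛ haΛ (by positivity) (by positivity)
    rw [hXdef, le_div_iff₀ (by positivity)]; nlinarith
  have hX0 : 0 < X := by linarith
  have hlogX1 : 1 ≤ Real.log X := by rw [Real.le_log_iff_exp_le hX0]; linarith [Real.exp_one_lt_d9]
  have hlogX : Real.log X ≤ X := by linarith [Real.log_le_sub_one_of_pos hX0]
  have hll0 : 0 ≤ Real.log (Real.log X) := Real.log_nonneg hlogX1
  have hll : Real.log (Real.log X) ≤ X := by linarith [Real.log_le_sub_one_of_pos (by linarith : 0 < Real.log X)]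
  have haf : afBeta Nf Λ (reg.a k) ≤ K₁ * X := by
    change 2 * betaCoeff₀ Nf * Real.log X + 2 * (betaCoeff₁ Nf / betaCoeff₀ Nf) * Real.log (Real.log X) ≤ _
    have h1 : 2 * (betaCoeff₁ Nf / betaCoeff₀ Nf) * Real.log (Real.log X) ≤ 2 * |betaCoeff₁ Nf / betaCoeff₀ Nf| * X :=
      (mul_le_mul_of_nonneg_right (by linarith [le_abs_self (betaCoeff₁ Nf / betaCoeff₀ Nf)]) hll0).trans
        (mul_le_mul_of_nonneg_left hll (by positivity))
    rw [hK₁, add_mul]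
    exact add_le_add (mul_le_mul_of_nonneg_left hlogX (by positivity)) h1
  have hXa : X = (reg.a k)⁻¹ ^ 2 / Λ ^ 2 := by rw [hXdef]; field_simp
  have hinv1 : 1 ≤ (reg.a k)⁻¹ ^ 2 := by nlinarith [(one_le_inv₀ hapos).2 ha1.le]
  have hK₁0 : 0 ≤ K₁ / Λ ^ 2 := by positivity
  calc reg.β k ≤ 1 + K₁ * X := by linarith
    _ = 1 + K₁ / Λ ^ 2 * (reg.a k)⁻¹ ^ 2 := by rw [hXa]; ring
    _ ≤ 1 * (reg.a k)⁻¹ ^ 2 + K₁ / Λ ^ 2 * (reg.a k)⁻¹ ^ 2 := by nlinarith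
    _ = (1 + K₁ / Λ ^ 2) * (reg.a k)⁻¹ ^ 2 := by ring

/-- **Polynomial currency.**  Under mass scaling (`Z_k ≥ c_Z/2` eventually, as in `WeylWindow.eventually_a_le_mul_Zm`),
asymptotic scaling (`eventually_beta_le`) and CAP (`L_k ≤ a_k^{-p₀}`): for every `N` and exponent `q ≥ 0` there are `K, p`
with, eventually in `k`, `N ≤ L_k`, `1 ≤ β_k` and `(2L_k+1)⁴ (1 + β_k^q) ≤ K (Z_k/a_k)^p`. -/
theorem eventually_poly_bound (hNf : Nf ≤ 16) (reg : QCDRegularisation Nf) (hMS : reg.HasMassScaling)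
    (hAS : (reg.scheme 0 0 0).HasAsymptoticScaling)
    (hCAP : ∃ p : ℕ, ∀ᶠ k in atTop, (reg.L k : ℝ) ≤ (reg.a k)⁻¹ ^ p) (N : ℕ) {q : ℝ} (hq : 0 ≤ q) :
    ∃ K p : ℝ, 0 < K ∧ ∀ᶠ k in atTop, N ≤ reg.L k ∧ 1 ≤ reg.β k ∧
      (2 * (reg.L k : ℝ) + 1) ^ 4 * (1 + reg.β k ^ q) ≤ K * ((reg.a k)⁻¹ * reg.Zm k) ^ p := by
  obtain ⟨p₀, hp₀⟩ := hCAP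
  obtain ⟨cZ, hcZ, hZ⟩ := hMS
  obtain ⟨Kβ, hKβ, hβ⟩ := eventually_beta_le hNf reg hAS
  have hexp : 0 ≤ massExponent Nf := by
    have h16 : (Nf : ℝ) ≤ 16 := by exact_mod_cast hNf
    unfold massExponent gammaCoeff₀ betaCoeff₀
    exact div_nonneg (by positivity) (mul_nonneg (by norm_num) (div_nonneg (by linarith) (by positivity)))
  set pr : ℝ := 4 * (p₀ : ℝ) + 2 * q with hpr
  refine ⟨162 * Kβ ^ q * (cZ / 2) ^ (-pr), pr, by positivity, ?_⟩
  filter_upwards [hp₀, hβ, reg.tendsto_a.eventually (eventually_lt_nhds (by norm_num : (0:ℝ) < 1 / 2)),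
    (tendsto_order.1 hZ).1 (cZ / 2) (by linarith), reg.tendsto_L.eventually_ge_atTop (N : ℝ)] with k hL hb ha hr hNk
  obtain ⟨hb1, hb2⟩ := hb
  have hapos := reg.a_pos k
  refine ⟨?_, hb1, ?_⟩
  · have : reg.a k * reg.L k ≤ reg.L k := by nlinarith [(Nat.cast_nonneg (reg.L k) : (0 : ℝ) ≤ reg.L k)]
    exact_mod_cast hNk.trans this
  -- `Z_k ≥ cZ/2`: `log(1/a²) ≥ 1` once `a < 1/2`
  have hz : cZ / 2 ≤ reg.Zm k := by
    have hlog : 1 ≤ Real.log (1 / reg.a k ^ 2) := by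
      have haa : reg.a k * reg.a k < 1 / 2 * (1 / 2) := mul_lt_mul'' ha ha hapos.le hapos.le
      rw [Real.le_log_iff_exp_le (by positivity), le_div_iff₀ (by positivity)]
      nlinarith [Real.exp_one_lt_d9]
    have h1 := (lt_div_iff₀ (lt_of_lt_of_le one_pos (Real.one_le_rpow hlog hexp))).1 hr
    nlinarith [Real.one_le_rpow hlog hexp]
  set u : ℝ := (reg.a k)⁻¹ with hu
  have hu0 : 0 < u := inv_pos.2 hapos
  have hu1 : 1 ≤ u := (one_le_inv₀ hapos).2 (by linarith)
  have h1 : (2 * (reg.L k : ℝ) + 1) ^ 4 ≤ 81 * u ^ (4 * (p₀ : ℝ)) := by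
    have hup : 1 ≤ u ^ p₀ := one_le_pow₀ hu1
    have h3 : 2 * (reg.L k : ℝ) + 1 ≤ 3 * u ^ p₀ := by linarith
    calc (2 * (reg.L k : ℝ) + 1) ^ 4 ≤ (3 * u ^ p₀) ^ 4 := pow_le_pow_left₀ (by positivity) h3 4
      _ = 81 * u ^ (4 * p₀) := by rw [mul_pow, pow_mul']; norm_num
      _ = 81 * u ^ (4 * (p₀ : ℝ)) := by rw [← Real.rpow_natCast u (4 * p₀)]; push_cast; ring_nf
  have h2 : 1 + reg.β k ^ q ≤ 2 * Kβ ^ q * u ^ (2 * q) := by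
    have hbq : reg.β k ^ q ≤ (Kβ * u ^ 2) ^ q := Real.rpow_le_rpow (by linarith) hb2 hq
    have h1q : 1 ≤ reg.β k ^ q := Real.one_le_rpow hb1 hq
    have heq : (Kβ * u ^ 2) ^ q = Kβ ^ q * u ^ (2 * q) := by
      rw [Real.mul_rpow hKβ.le (by positivity), Real.rpow_mul hu0.le]; norm_num
    linarith
  have h4 : u ^ pr ≤ (cZ / 2) ^ (-pr) * (u * reg.Zm k) ^ pr := by
    have huY : u ≤ u * reg.Zm k / (cZ / 2) := by
      rw [le_div_iff₀ (by positivity)]; exact mul_le_mul_of_nonneg_left hz hu0.le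
    calc u ^ pr ≤ (u * reg.Zm k / (cZ / 2)) ^ pr := Real.rpow_le_rpow hu0.le huY (by positivity)
      _ = _ := by rw [Real.div_rpow (mul_nonneg hu0.le (reg.Zm_pos k).le) (by positivity), Real.rpow_neg (by positivity),
          div_eq_inv_mul]
  calc (2 * (reg.L k : ℝ) + 1) ^ 4 * (1 + reg.β k ^ q) ≤ (81 * u ^ (4 * (p₀ : ℝ))) * (2 * Kβ ^ q * u ^ (2 * q)) :=
        mul_le_mul h1 h2 (by positivity) (by positivity)
    _ = 162 * Kβ ^ q * u ^ pr := by rw [hpr, Real.rpow_add hu0]; ring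
    _ ≤ 162 * Kβ ^ q * ((cZ / 2) ^ (-pr) * (u * reg.Zm k) ^ pr) := mul_le_mul_of_nonneg_left h4 (by positivity)
    _ = _ := by ring

end Bookkeeping


end Summit.QuantumFields.QCD.Cruxes.ExtinctionBuildsQCD.DeterminantTilt

end
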